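import Literature.MathematicalPhysics.QuantumFieldTheory.Balaban1983to89.B9Eq326DeltaAHQKLetters
import Literature.MathematicalPhysics.QuantumFieldTheory.Balaban1983to89.B9Eq3126H1BlockDecay
import Literature.MathematicalPhysics.QuantumFieldTheory.Balaban1983to89.B9Eq315QAdjointFarField
import Literature.MathematicalPhysics.QuantumFieldTheory.Balaban1983to89.B9Eq315QTorusOnto

/-!
# `Balaban1983to89.B9Eq3126H1BlockDecayClosed` — T. Bałaban, *Propagators for lattice gauge theories in a background field*, Commun. Math. Phys. **99**
# (1985) 389–434 [Balaban1985BackgroundPropagators] (3.26) p. 395, (3.49) p. 399 («`|H(x, y)| ≤ O(1)e^{−δ₀d(x,y)}` … the constants … independent of the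
# field configuration»), (3.126) p. 420, Thm 3.11 p. 416 with [Balaban1985Variational] (45) p. 285, (103) p. 293: **THE ONE-STEP `L²` DECAY ROW OF
# `H₁(U) = G₁(U)Q(U)*(Q(U)G₁(U)Q(U)*)⁻¹` WITH EVERY CONJUGATION ∕ SIZE ∕ ONTO ∕ FAR-FIELD LETTER DISCHARGED AT `Q(U) := QtorusW`** — ne9-leaf-03's (H1D)
# `B9Eq3126H1BlockDecay.norm_block_H1ofU_le` composed BY NAME with gen 94's `B9Eq326DeltaAHQKLetters.hQK_of_chain` (`dQ ∧ dQ′ ∧ dK ∧ dR`),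
# `B9Eq325ProjectionDivergenceQuarterKappa` (`C_P`), g92's `p_K` floor, ne9-leaf-01's (N51) `B9Eq315QAdjointFarField` (`C_Q†`), ne9-leaf-01's
# `B9Eq316PenaltyPointwiseBound.norm_QtorusW_le` (`C_Q`) and E164 `B9Eq315QTorusOnto.QtorusW_surjective` («`Q` onto»).  Displayed then: `γ` (Thm 3.11 for
# `Δ_a`) with `hpos`, `μ₁` ([B11] (45): `QG₁Q† ≥ μ₁`), the `G′` side (`γ′, a′, hpos′, κ₁, M`), the MODEL letters and CLOSED windows

statement-level skeleton of published theorems with citation tags; proofs where landed; nothing here is a claim about the Yang–Mills mass gap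

CITATION HEADER (lean-in-tree rule).  Audit cell `pub-balaban`, sub-cell `t4`, BINDER row NE9; filed by the NE9 BINDER-row OWNER lineage
`b2b-balaban-t4-ne9-p1` (gen 94).  Imports gen 94's `B9Eq326DeltaAHQKLetters` (the binder `hQK_of_chain`; through it (GBD v2), (PDC), QuarterKappa, the
companion letters), ne9-leaf-03's (H1D) `B9Eq3126H1BlockDecay`, ne9-leaf-01's `B9Eq315QAdjointFarField` (+ `B9Eq316PenaltyPointwiseBound` through it) and
this lineage's E164 `B9Eq315QTorusOnto`.  Sources READ first-hand (`paper:balaban1985-cmp99-background-propagators`): p. 395 (3.26), p. 399 (3.49), p. 420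
(3.126), p. 416 Thm 3.11; [Balaban1985Variational] p. 285 (45), p. 293 (103).  Print's decay proof is the random walk of Sect. C; the cell's road is
Combes–Thomas (road B8″ ∕ ΔA-CT) and every constant below is the cell's; `μ₁` is [B11] (45) DISPLAYED, not proved.

WHAT IS PROVED (sorry-free; proof lane — no `def`; [folklore] composition BY NAME).
* **`norm_block_H1ofU_le_closed`** — on the one-step torus (`ηL = 1`, `1 ≤ m_i`, `1 ≤ L`, `50(d+1)αL^d ≤ ½`, `0 ≤ α`), for `Δ_a(U)` at `Q := QtorusW` and every
  background of the MODEL letters: given `γ`-coercivity + `hpos` (`γ ≤ 1`), `QG₁Q† ≥ μ₁`, the `G′` side letters and the CLOSED windows of `B9Eq326DeltaAHQKLetters`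
  §3 plus (H1D)'s `β ≤ 1`, `β_K ≥ 0`, `small2` (at `C_Q := M_φ′M_φ(1+50(d+1)α)√(2dc₁∕c₀)`, `C_P := √(M∕√κ₁)`): for every `0 ≤ r′ < r`,
  `‖P_{y₁} ∘ H₁(U) ∘ r_{y₀}‖ ≤ (4∕γ)e^{r}·(C_Q·e^{r})·(2∕μ₁)e^{r}·K_d(r − r′)²·e^{−r′·d_m(y₀,y₁)}`.
HONEST SCOPE.  Composition; `γ`, `μ₁`, `hpos`, `γ′`, `a′`, `hpos′`, `κ₁`, `M` DISPLAYED; one step; crude constants; nothing of [B9] Thm 3.1∕3.3∕3.11 or [B11] (45)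
asserted, valued or discharged; «NE9 ⇐ the named binders»; NE9 NOT PRINTED ∕ NOT PROVED; row WALLED ON A MODEL (O-NE9-1; #5 UNRULED); spine PROVED 0∕9; rung
(B)+1 on a finite T⁴ — NOT infinite volume, NOT mass gap, NOT BetaPertH, NOT Clay.  HONEST DEPENDENCY: continuum YM on T⁴ ⇐ BetaPertH ∧ nine spine estimates
(0/9 proved); BetaPertH ⇐ (D1) ∧ (D4) ∧ CAP+tail.  NEW file; nothing modified.  Net new unproved facts: 0.
-/

noncomputable section

set_option autoImplicit false

open scoped InnerProductSpace ComplexConjugate BigOperators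
open NormedSpace

namespace Literature.MathematicalPhysics.QuantumFieldTheory.Balaban1983to89.B9Eq3126H1BlockDecayClosed

open B4Sect5Torus (TSite tdist)
open B4Sect5Proof (latticeConst)
open B9SectCLatticeCarrier (Bond DirPair bpos btgt)
open B9Eq311L2Pairing (WL2)
open B9Eq319QprimeTorus (fineP blockCoord)
open B7Prop1Explicit (U1 Wcx boxVec)
open B11Eq103H1Complex (SiteL2K BondL2K covDerivL2K covDivL2K)
open B9Eq310DeltaPrime (reHol imHol)
open B9Eq310HessianOperator (adTransportW curvOp)
open B9Eq315QTorus (perCfg cornerSite QtorusW)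
open B9Eq326OperatorAssembly (QprimeW RofU laplaceAofU G1ofU H1ofU)
open B9Eq3119DeltaPiCarrier (laplacePrimeA GpOfU)
open B9Eq3126H1BlockDecay (norm_block_H1ofU_le)
open B9Eq326DeltaAHQKLetters (hQK_of_chain)
open B9Eq369CurvFormL2 (re_inner_curvOp_self_ge)
open B9Eq315QAdjointFarField (norm_block_adjoint_QtorusW_le_of_class)
open B9Eq316PenaltyPointwiseBound (norm_QtorusW_le)
open B9Eq315QTorusOnto (QtorusW_surjective)

variable {d : ℕ} (L : ℕ) [NeZero L] (m : Fin d → ℕ) [∀ i, NeZero (m i)] [∀ i, NeZero (fineP L m i)]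
  {𝔸 : Type*} [NormedRing 𝔸] [StarRing 𝔸] [NormedAlgebra ℂ 𝔸] [StarModule ℂ 𝔸] [NormOneClass 𝔸] [CompleteSpace 𝔸] (hL : 1 ≤ L)
  {W : Type*} [NormedAddCommGroup W] [InnerProductSpace ℂ W] [FiniteDimensional ℂ W] (φ : W ≃ₗ[ℂ] 𝔸) {Mφ Mφ' : ℝ}
  (hφ : ∀ w, ‖φ w‖ ≤ Mφ * ‖w‖) (hφ' : ∀ X, ‖φ.symm X‖ ≤ Mφ' * ‖X‖) (hMφ : 0 ≤ Mφ) (hMφ' : 0 ≤ Mφ') (hstar : ∀ X : 𝔸, ‖star X‖ ≤ ‖X‖)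
  {c₀ c₁ : ℝ} [Fact (0 < c₀)] [Fact (0 < c₁)] (hc : c₁ = (L : ℝ) ^ d * c₀) {η : ℝ} (hη : 0 < η) (hηL : η * L = 1)
  (U : Bond d (fineP L m) → 𝔸ˣ) (hU : ∀ b, U b ∈ U1 𝔸)
  (hRS : ∀ (b : Bond d (fineP L m)) (v u : W), ⟪adTransportW φ U b v, u⟫_ℂ = ⟪v, adTransportW φ (fun b => (U b)⁻¹) b u⟫_ℂ)
  {α : ℝ} (hα0 : 0 ≤ α) (hα1 : α ≤ 1 / 64) (hαL : 50 * (d + 1) * α * (L : ℝ) ^ d ≤ 1 / 2)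
  (hU1 : ∀ (x : B7Prop1Explicit.Site d) (k : Fin d), perCfg (fineP L m) U x k ∈ U1 𝔸)
  (hreg : ∀ (y : TSite d m) (k : Fin d) (ρ' : Fin d → Fin L),
    ‖((Wcx L (perCfg (fineP L m) U) (cornerSite L y) k (boxVec L ρ') : 𝔸ˣ) : 𝔸) - 1‖ ≤ α)
  {α' : ℝ} (hα1' : α' ≤ 1 / 64)
  (hU1' : ∀ (x : B7Prop1Explicit.Site d) (k : Fin d), perCfg (fineP L m) (fun _ : Bond d (fineP L m) => (1 : 𝔸ˣ)) x k ∈ U1 𝔸)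
  (hreg' : ∀ (y : TSite d m) (k : Fin d) (ρ' : Fin d → Fin L),
    ‖((Wcx L (perCfg (fineP L m) (fun _ : Bond d (fineP L m) => (1 : 𝔸ˣ))) (cornerSite L y) k (boxVec L ρ') : 𝔸ˣ) : 𝔸) - 1‖ ≤ α')
  {εU : ℝ} (hεU : 0 ≤ εU) (hUε : ∀ b : Bond d (fineP L m), ‖(U b : 𝔸) - 1‖ ≤ εU)
  (τ : 𝔸 →ₗ[ℂ] ℂ) {Mτ : ℝ} (hτ : ∀ X Y : 𝔸, ‖τ (X * Y)‖ ≤ Mτ * ‖X‖ * ‖Y‖) (hMτ : 0 ≤ Mτ)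
  {δ : ℝ} (hδ : 0 ≤ δ)
  (hRe : ∀ p : B9SectCLatticeCarrier.Plaq d (fineP L m), ‖reHol U p - 1‖ ≤ δ)
  (hIm : ∀ p : B9SectCLatticeCarrier.Plaq d (fineP L m), ‖imHol U p‖ ≤ δ)
  {a' : ℝ} (ha' : 0 ≤ a')
  (hpos' : ∀ x : SiteL2K ℂ d (fineP L m) c₀ W, x ≠ 0 → 0 < RCLike.re ⟪x, laplacePrimeA L m φ η U a' (c₁ := c₁) x⟫_ℂ)
  {γ' κ₁ M : ℝ} (hγ' : 0 < γ') (hγ'1 : γ' ≤ 1) (hκ₁ : 0 < κ₁) (hM : 0 ≤ M)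
  (coercive : ∀ f : SiteL2K ℂ d (fineP L m) c₀ W, γ' * ‖f‖ ^ 2 ≤ ‖(covDerivL2K ℂ c₀ ((η : ℂ))⁻¹ (adTransportW φ U)) f‖ ^ 2 +
    a' * ‖((WL2.linearEquiv ℂ ℂ (fun _ : TSite d m => c₁)).symm.toLinearMap ∘ₗ QprimeW L m φ U (c₀ := c₀)) f‖ ^ 2)
  (hκ : ∀ ψ : SiteL2K ℂ d m c₁ W, κ₁ * ‖ψ‖ ^ 2 ≤ RCLike.re ⟪ψ,
    (((WL2.linearEquiv ℂ ℂ (fun _ : TSite d m => c₁)).symm.toLinearMap ∘ₗ QprimeW L m φ U (c₀ := c₀)) ∘ₗ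
      GpOfU L m φ η U a' (c₁ := c₁) hpos' ∘ₗ GpOfU L m φ η U a' (c₁ := c₁) hpos' ∘ₗ
      LinearMap.adjoint ((WL2.linearEquiv ℂ ℂ (fun _ : TSite d m => c₁)).symm.toLinearMap ∘ₗ QprimeW L m φ U (c₀ := c₀))) ψ⟫_ℂ)
  (hMQ : ∀ s : SiteL2K ℂ d (fineP L m) c₀ W, ‖((WL2.linearEquiv ℂ ℂ (fun _ : TSite d m => c₁)).symm.toLinearMap ∘ₗ QprimeW L m φ U (c₀ := c₀)) s‖ ≤ M * ‖s‖)
  {r ℓ ℓ' β βK β' ρ : ℝ} (hr : 0 ≤ r) (hℓ : 1 ≤ ℓ) (hℓ' : 1 ≤ ℓ') (hβ'0 : 0 ≤ β') (hβ'1 : β' ≤ 1)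
  (hwin : r * ℓ * η ≤ 1) (hwinQ : r * (3 * ℓ' + L * (ℓ * η)) ≤ 1) (hwin' : r * ℓ' ≤ 1)
  (hβQ : 2 * (r * (3 * ℓ' + L * (ℓ * η))) * (Mφ' * Mφ * Real.sqrt (2 * (c₁ / c₀) * (2 * d * (102 * (d + 1) ^ 2 * L * εU) ^ 2 + ((L : ℝ) ^ d)⁻¹))) ≤ β)
  (hβK : 8 * (r * (ℓ * η)) * (768 * Fintype.card (DirPair d) * Mτ * Mφ ^ 2 * (‖((η : ℂ)) ^ d‖ / c₀) * ‖((η : ℂ))⁻¹‖ ^ 2 * δ) ≤ βK)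
  (hβ'D : 2 * r * ℓ * (Mφ * Mφ') * Real.sqrt d ≤ β') (hβ'Q : 2 * r * ℓ' * (1 + 2 * Mφ * Mφ' * εU) ^ (d * (L - 1)) ≤ β')
  (small' : 3 * (1 + a') * β' ^ 2 ≤ γ' / 4) (hwinκ : 12 * (β' * (4 / γ' + M * ((4 / γ') ^ 2 * (3 + a' * (2 * M + 1))))) ≤ Real.sqrt κ₁)
  (hρ : (6 * (β' * (4 / γ' + M * ((4 / γ') ^ 2 * (3 + a' * (2 * M + 1))))) + 9 * (β' * (4 / γ' + M * ((4 / γ') ^ 2 * (3 + a' * (2 * M + 1)))))) /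
    Real.sqrt κ₁ ≤ ρ)

include hφ hφ' hMφ hMφ' hstar hc hη hηL hU hRS hα0 hαL hα1' hU1' hreg' hεU hUε hτ hMτ hδ hRe hIm ha' hγ' hγ'1 hκ₁ hM coercive hκ hMQ hr hℓ hℓ' hβ'0 hβ'1
  hwin hwinQ hwin' hβQ hβK hβ'D hβ'Q small' hwinκ hρ in
/-- **THE ONE-STEP `L²` DECAY ROW OF `H₁(U)` WITH EVERY CONJUGATION ∕ SIZE ∕ ONTO ∕ FAR-FIELD LETTER DISCHARGED** ([B9] (3.49) ∕ [B11] (103) SHAPE at the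
cell's rate): for `Δ_a(U)` at `Q := QtorusW`, given `γ`-coercivity + `hpos` (`γ ≤ 1`), `QG₁Q† ≥ μ₁`, the `G′`-side letters, the MODEL letters and the CLOSED
windows (`β ≤ 1`, `0 ≤ β_K`, `ρ ≤ 1∕8`, the three `β`-windows, `small` at `C_P := √(M∕√κ₁)`, `small2` at `C_Q := M_φ′M_φ(1+50(d+1)α)√(2dc₁∕c₀)`), every
`0 ≤ r′ < r`: `‖P_{y₁} ∘ H₁(U) ∘ r_{y₀}‖ ≤ (4∕γ)e^{r}·(C_Q·e^{r})·(2∕μ₁)e^{r}·K_d(r − r′)²·e^{−r′·d_m(y₀,y₁)}` — (H1D) with `hQK := hQK_of_chain`, `hP :=` QuarterKappa,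
`hKre :=` g92, `hQ := norm_QtorusW_le`, `hQs := QtorusW_surjective`, `hQa := norm_block_adjoint_QtorusW_le_of_class`.
[cite: Balaban1985BackgroundPropagators, (3.26) p.395, (3.49) p.399, (3.126) p.420, Thm 3.11 p.416; Balaban1985Variational, (45) p.285, (103) p.293] -/
theorem norm_block_H1ofU_le_closed (a : ℝ) (ha : 0 ≤ a) (hm : ∀ i, 1 ≤ m i)
    (hpos : ∀ x : BondL2K ℂ d (fineP L m) c₀ W, x ≠ 0 →
      0 < RCLike.re ⟪x, laplaceAofU L m φ η U τ (QtorusW L m hL φ U hα1 hU1 hreg (c₀ := c₀) (c₁ := c₁)) a x⟫_ℂ)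
    {γ μ₁ : ℝ} (hγ : 0 < γ) (hγ1 : γ ≤ 1) (hβ : 0 ≤ β) (hβ1 : β ≤ 1) (hβK0 : 0 ≤ βK) (hρ0 : 0 ≤ ρ) (hρ8 : ρ ≤ 1 / 8) (hμ₁ : 0 < μ₁)
    (hcoer : ∀ f : BondL2K ℂ d (fineP L m) c₀ W,
      γ * ‖f‖ ^ 2 ≤ RCLike.re ⟪f, laplaceAofU L m φ η U τ (QtorusW L m hL φ U hα1 hU1 hreg (c₀ := c₀) (c₁ := c₁)) a f⟫_ℂ)
    (hX1 : ∀ g : BondL2K ℂ d m c₁ W, μ₁ * ‖g‖ ^ 2 ≤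
      RCLike.re ⟪g, QtorusW L m hL φ U hα1 hU1 hreg (c₀ := c₀) (c₁ := c₁)
        (G1ofU L m φ η U τ (Q := QtorusW L m hL φ U hα1 hU1 hreg (c₀ := c₀) (c₁ := c₁)) (a := a) hpos
          (LinearMap.adjoint (QtorusW L m hL φ U hα1 hU1 hreg (c₀ := c₀) (c₁ := c₁)) g))⟫_ℂ)
    (hβCC : 4 * r * ℓ * (Mφ * Mφ') * (d * Real.sqrt d) ≤ β) (hβC : 4 * r * ℓ * (Mφ * Mφ') * d ≤ β)
    (hβD : 2 * r * ℓ * (Mφ * Mφ') * Real.sqrt d ≤ β)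
    (small : (768 * Fintype.card (DirPair d) * Mτ * Mφ ^ 2 * (‖((η : ℂ)) ^ d‖ / c₀) * ‖((η : ℂ))⁻¹‖ ^ 2 * δ) / 2 + (21 + 3 * a) * β ^ 2 +
      4 * β * Real.sqrt (M / Real.sqrt κ₁) + 2 * ρ * (Real.sqrt (M / Real.sqrt κ₁)) ^ 2 + βK ≤ γ / 4)
    (small2 : β * (4 / γ) * (2 * (Mφ' * Mφ * (1 + 50 * (d + 1) * α) * Real.sqrt (2 * d * c₁ / c₀)) + 1) +
      (Mφ' * Mφ * (1 + 50 * (d + 1) * α) * Real.sqrt (2 * d * c₁ / c₀)) * ((Mφ' * Mφ * (1 + 50 * (d + 1) * α) * Real.sqrt (2 * d * c₁ / c₀)) + 1) *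
        (β * (4 / γ * (2 * (8 / γ) + (8 / γ + 4 / γ) + 2 * ((8 / γ + 4 / γ * Real.sqrt (M / Real.sqrt κ₁)) + 4 / γ) +
          a * (Mφ' * Mφ * (1 + 50 * (d + 1) * α) * Real.sqrt (2 * d * c₁ / c₀)) * (4 / γ) +
          a * ((Mφ' * Mφ * (1 + 50 * (d + 1) * α) * Real.sqrt (2 * d * c₁ / c₀)) + 1) * (4 / γ))) +
          ρ * ((8 / γ + 4 / γ * Real.sqrt (M / Real.sqrt κ₁)) * ((8 / γ + 4 / γ * Real.sqrt (M / Real.sqrt κ₁)) + 4 / γ)) +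
          βK * (4 / γ) ^ 2) ≤ μ₁ / 2)
    (PB : TSite d m → BondL2K ℂ d (fineP L m) c₀ W →L[ℂ] BondL2K ℂ d (fineP L m) c₀ W)
    (hPB : ∀ (y : TSite d m) (f : BondL2K ℂ d (fineP L m) c₀ W) (b : Bond d (fineP L m)),
      WL2.equiv ℂ (fun _ : Bond d (fineP L m) => c₀) W (PB y f) b =
        if blockCoord L m (bpos b) = y then WL2.equiv ℂ (fun _ : Bond d (fineP L m) => c₀) W f b else 0)
    {rF : TSite d m → BondL2K ℂ d m c₁ W →L[ℂ] BondL2K ℂ d m c₁ W}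
    (hrF : ∀ (y : TSite d m) (g : BondL2K ℂ d m c₁ W) (b' : Bond d m),
      WL2.equiv ℂ (fun _ : Bond d m => c₁) W (rF y g) b' = if bpos b' = y then WL2.equiv ℂ (fun _ : Bond d m => c₁) W g b' else 0)
    {r' : ℝ} (hr' : 0 ≤ r') (hr'r : r' < r) (y₀ y₁ : TSite d m) :
    ‖PB y₁ ∘L LinearMap.toContinuousLinearMap
        (H1ofU L m φ η U τ (Q := QtorusW L m hL φ U hα1 hU1 hreg (c₀ := c₀) (c₁ := c₁)) (a := a) hpos
          (QtorusW_surjective L m hL U hα1 hU1 hreg hαL φ (c₀ := c₀) (c₁ := c₁))) ∘L rF y₀‖ ≤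
      (4 / γ * Real.exp r) * (Mφ' * Mφ * (1 + 50 * (d + 1) * α) * Real.sqrt (2 * d * c₁ / c₀) * Real.exp (r * 1)) * (2 / μ₁ * Real.exp r) *
        latticeConst d (r - r') ^ 2 * Real.exp (-(r' * tdist m y₀ y₁)) := by
  have hKre : ∀ f : BondL2K ℂ d (fineP L m) c₀ W,
      -((768 * Fintype.card (DirPair d) * Mτ * Mφ ^ 2 * (‖((η : ℂ)) ^ d‖ / c₀) * ‖((η : ℂ))⁻¹‖ ^ 2 * δ) * ‖f‖ ^ 2) ≤
        RCLike.re ⟪f, curvOp φ τ η U f⟫_ℂ :=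
    fun f => re_inner_curvOp_self_ge φ hφ hstar τ hτ hMτ η U (fun b => B7Prop1Explicit.mem_U1.mp (hU b)) hδ hRe hIm f
  have hCQ0 : 0 ≤ Mφ' * Mφ * (1 + 50 * (d + 1) * α) * Real.sqrt (2 * d * c₁ / c₀) := by positivity
  exact norm_block_H1ofU_le φ hφ hφ' hMφ hMφ' hη hηL U hU hRS τ _ a ha hm hL hpos _ hγ hγ1 hβ hβ1 hβK0 hℓ hℓ' hr hρ0 hρ8 (by positivity) hCQ0 hμ₁ hcoer
    hX1 hKre (norm_QtorusW_le L m hL U hα1 hU1 hreg φ hMφ hφ hMφ' hφ' (c₁ := c₁)) hwin hβCC hβC hβD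
    (hQK_of_chain L m hL φ hφ hφ' hMφ hMφ' hstar hc hη U hU hRS hα1 hU1 hreg hα1' hU1' hreg' hεU hUε τ hτ hMτ hδ hRe hIm ha' hpos' hγ' hγ'1 hκ₁ hM
      coercive hκ hMQ hℓ hℓ' hβ'0 hβ'1 hwin hwinQ hwin' hβQ hβK hβ'D hβ'Q small' hwinκ hρ)
    (B9Eq325ProjectionDivergenceQuarterKappa.norm_one_sub_RofU_covDivL2K_le_sqrt L m φ c₀ η U c₁ a' hRS hpos' ha' hM hκ₁ hMQ hκ)
    small small2 PB hPB hrF (by positivity) hr' hr'r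
    (fun z z' => norm_block_adjoint_QtorusW_le_of_class L m hL U hα1 hU1 hreg φ hφ hφ' hMφ hMφ' hPB hrF hm hα0 hr z z') y₀ y₁

end Literature.MathematicalPhysics.QuantumFieldTheory.Balaban1983to89.B9Eq3126H1BlockDecayClosed

end
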